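import Literature.Algebra.Lie.ChevalleyEilenbergCasimirHomotopy
import Mathlib.Algebra.Order.BigOperators.Group.Finset
import Mathlib.Data.Fin.Tuple.Basic
import Mathlib.Tactic.Linarith
import Mathlib.Tactic.LinearCombination
import HarnessLib

/-!
# Kuga's lemma on the Chevalley–Eilenberg complex, in every degree: the Casimir homotopy is the
# formal adjoint of `d`, and a null Laplacian forces relative cochains to be closed and coclosed

Topic `Algebra/Lie`; namespace `Literature.Algebra.Lie.ChevalleyEilenberg` (continues
`ChevalleyEilenbergComplex`, `…PostComposition`, `…CasimirHomotopy`).  Definitions with bodies and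
theorems only; no named fact, no `sorry`.

This is the algebra of [cite: BorelWallach2000, II §2.2–2.4, Thm. 2.5 (iii) and Prop. 3.1 (b)]
(Matsushima–Murakami, Kuga) on the tree's recursively defined Chevalley–Eilenberg operators, for an
ARBITRARY commutative coefficient ring `R` (the positivity statements over a linearly ordered one).

**Setting.**  `L` a Lie algebra over `R` acting on `M` (`⁅x, m⁆`, in the application
`τ = σ ⊗ 1 + 1 ⊗ ρ` on `M = H ⊗ E`), `K ≤ L` a Lie subalgebra (`𝔨`), `x : ι → L` a finite family
(an orthonormal basis of `𝔭`) with `⁅x i, x j⁆ ∈ K` (`[𝔭, 𝔭] ⊆ 𝔨`), a bilinear form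
`B : M → M → R` (the real part of `( , )_H ⊗ ( , )_E`) and a linear `s : L → End_R M` with the
ADJUNCTION RELATION `B ⁅x i, a⁆ b = - B a (s (x i) b)` — for `τ = σ ⊗ ρ` with `σ` unitary and `ρ`
admissible this is `s(x) = σ(x) - ρ(x) = -τ(x)^*` on `𝔭` [cite: BorelWallach2000, II 2.2 (5)].

* `cochainForm B x q f g = ∑_{I : Fin q → ι} B (f (x ∘ I)) (g (x ∘ I))` — the scalar product
  `2.2 (3)` of loc. cit. summed over ALL `q`-tuples of basis vectors (`= q!` times the sum over
  subsets; recursion `cochainForm_succ`: `⟪f, g⟫_{q+1} = ∑_i ⟪i_{x_i} f, i_{x_i} g⟫_q`).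

**Results** (all for `K`-HORIZONTAL cochains, `i_y f = 0` for `y ∈ K`, which is what the
inductions need; relative cochains are horizontal):

* `cochainForm_lieDer_left` — `⟪θ_{x_i} f, g⟫_q = -⟪f, s(x_i) ∘ g⟫_q`: on basis tuples
  `θ_{x_i} f = τ(x_i) ∘ f` because the bracket terms `f(…, ⁅x_i, x_j⁆, …)` have an argument in `𝔨`.
* **`cochainForm_d_left`** — `⟪d f, g⟫_{q+1} = -(q+1) ⟪f, h g⟫_q` with
  `h = casimirHomotopy s x x q = ∑_i s(x_i) ∘ i_{x_i}`: the Casimir homotopy of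
  `ChevalleyEilenbergCasimirHomotopy` built on the `𝔭`-part of the Casimir tensor IS (minus, and up
  to the normalisation `q + 1`) the formal adjoint `∂` of [cite: BorelWallach2000, II Prop. 2.3 (1)–(2)]
  (proved by induction on the degree through Cartan's formula `i_y d = θ_y - d i_y`, the defining
  recursion of the tree's `d`, and `i_y h = -h i_y`).
* **`d_eq_zero_and_casimirHomotopy_eq_zero`** (Kuga / [cite: BorelWallach2000, II 2.4 (1)–(2) and
  Prop. 3.1 (b)]) — over a linearly ordered `R`, with `B` symmetric, positive semidefinite and
  definite, and `L = K + span {x i}`: a RELATIVE cochain `g` of positive degree whose Laplacian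
  vanishes, `d (h g) + h (d g) = 0`, is closed AND coclosed, `d g = 0` and `h g = 0`
  (`0 = ⟪(dh + hd) g, g⟫ = -(q+1) ‖h g‖² - ‖d g‖²/(q+2)`); `d_eq_zero_of_rel_zero` is the degree-`0`
  case.  The hypothesis is supplied by the homotopy identity `d h + h d = N ∘ -`
  (`d_casimirHomotopy_add`) whenever the Casimir-type operator `N` kills `M` — the Casimir match
  `σ(C) = ρ(C)` of a cohomological unitary `(𝔤, K)`-module, Wigner/Kuga:
  **`d_eq_zero_of_casimirOp_eq_zero`** packages this for the full tensor
  `∑_i x_i ⊗ x_i + ∑_α w_α ⊗ w'_α` with `w'_α ∈ 𝔨` (whose `𝔨`-part of the homotopy dies on horizontal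
  cochains, `casimirHomotopy_sumElim_eq`).
* `eq_zero_of_cochainForm_self_eq_zero` — a horizontal cochain with `⟪f, f⟫ = 0` vanishes
  (definiteness on `𝔭`-tuples + `L = 𝔨 + 𝔭` + alternation).

These are the two algebraic facts behind "cuspidal cochains are harmonic, closed and coclosed"
(Borel's injectivity of cuspidal cohomology, Step 2 of `ResGLnCuspidalCohomologyApex`; Clozel's
cocycle) in every degree; the tree's `KugaLemmaDegreeOne` is the coordinate form in degree one.

## References

* A. Borel, N. Wallach, *Continuous cohomology, discrete subgroups, and representations of reductive
  groups*, 2nd ed., Math. Surveys Monogr. 67 (2000), II §2.2 (3)–(5), Prop. 2.3, §2.4 (1)–(2),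
  Thm. 2.5, Prop. 3.1 (held; read pp. 59–62). [BorelWallach2000]
* Y. Matsushima, S. Murakami, Ann. of Math. 78 (1963), §6 (the original computation; not held).
  [MatsushimaMurakami1963]
-/

open Finset

namespace Literature.Algebra.Lie.ChevalleyEilenberg

variable {R : Type*} [CommRing R] {L : Type*} [LieRing L] [LieAlgebra R L]
  {M : Type*} [AddCommGroup M] [Module R M]
  {ι : Type*} [Fintype ι]

/-! ### The scalar product of cochains over basis tuples -/

section Form

variable (B : M →ₗ[R] M →ₗ[R] R) (x : ι → L)

/-- **The scalar product of `q`-cochains over the tuples of the family `x`**: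
`⟪f, g⟫_q = ∑_{I : Fin q → ι} B (f (x ∘ I)) (g (x ∘ I))` (`q!` times the scalar product
`2.2 (3)` of loc. cit. when `x` is an orthonormal basis of `𝔭`). [cite: BorelWallach2000, II 2.2 (3)] -/
def cochainForm (q : ℕ) (f g : Cochain R L M q) : R :=
  ∑ I : Fin q → ι, B (f (x ∘ I)) (g (x ∘ I))

/-- Unfolding. [folklore] -/
theorem cochainForm_apply (q : ℕ) (f g : Cochain R L M q) :
    cochainForm B x q f g = ∑ I : Fin q → ι, B (f (x ∘ I)) (g (x ∘ I)) :=
  rfl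

/-- In degree `0` the scalar product is `B` of the two values. [folklore] -/
theorem cochainForm_zero (f g : Cochain R L M 0) :
    cochainForm B x 0 f g = B (f ![]) (g ![]) := by
  rw [cochainForm_apply, Fintype.sum_unique,
    show x ∘ (default : Fin 0 → ι) = ![] from Subsingleton.elim (α := Fin 0 → L) _ _]

/-- **Recursion**: `⟪f, g⟫_{q+1} = ∑_i ⟪i_{x_i} f, i_{x_i} g⟫_q`. [folklore] -/
theorem cochainForm_succ (q : ℕ) (f g : Cochain R L M (q + 1)) :
    cochainForm B x (q + 1) f g = ∑ i, cochainForm B x q (ins q (x i) f) (ins q (x i) g) := by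
  rw [cochainForm_apply, ← Fintype.sum_equiv (Fin.consEquiv fun _ : Fin (q + 1) => ι)
    (fun p : ι × (Fin q → ι) => B (f (x ∘ Fin.cons p.1 p.2)) (g (x ∘ Fin.cons p.1 p.2)))
    (fun I : Fin (q + 1) → ι => B (f (x ∘ I)) (g (x ∘ I))) (fun p => rfl),
    Fintype.sum_prod_type]
  refine Finset.sum_congr rfl fun i _ => ?_
  rw [cochainForm_apply]
  refine Finset.sum_congr rfl fun I _ => ?_
  have hc : x ∘ Fin.cons i I = Matrix.vecCons (x i) (x ∘ I) := by
    funext j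
    refine Fin.cases ?_ (fun j => ?_) j
    · rfl
    · simp [Matrix.vecCons]
  rw [hc, ins_apply, ins_apply]

/-- Additivity in the first variable. [folklore] -/
theorem cochainForm_add_left (q : ℕ) (f f' g : Cochain R L M q) :
    cochainForm B x q (f + f') g = cochainForm B x q f g + cochainForm B x q f' g := by
  simp only [cochainForm_apply, AlternatingMap.add_apply, map_add, LinearMap.add_apply, sum_add_distrib]

/-- Additivity in the second variable. [folklore] -/
theorem cochainForm_add_right (q : ℕ) (f g g' : Cochain R L M q) :
    cochainForm B x q f (g + g') = cochainForm B x q f g + cochainForm B x q f g' := by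
  simp only [cochainForm_apply, AlternatingMap.add_apply, map_add, sum_add_distrib]

/-- Negation in the first variable. [folklore] -/
theorem cochainForm_neg_left (q : ℕ) (f g : Cochain R L M q) :
    cochainForm B x q (-f) g = -cochainForm B x q f g := by
  simp only [cochainForm_apply, AlternatingMap.neg_apply, map_neg, LinearMap.neg_apply, sum_neg_distrib]

/-- Negation in the second variable. [folklore] -/
theorem cochainForm_neg_right (q : ℕ) (f g : Cochain R L M q) :
    cochainForm B x q f (-g) = -cochainForm B x q f g := by
  simp only [cochainForm_apply, AlternatingMap.neg_apply, map_neg, sum_neg_distrib]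

/-- Subtraction in the first variable. [folklore] -/
theorem cochainForm_sub_left (q : ℕ) (f f' g : Cochain R L M q) :
    cochainForm B x q (f - f') g = cochainForm B x q f g - cochainForm B x q f' g := by
  rw [sub_eq_add_neg, cochainForm_add_left, cochainForm_neg_left, ← sub_eq_add_neg]

/-- Scalars in the first variable. [folklore] -/
theorem cochainForm_smul_left (q : ℕ) (c : R) (f g : Cochain R L M q) :
    cochainForm B x q (c • f) g = c * cochainForm B x q f g := by
  simp only [cochainForm_apply, AlternatingMap.smul_apply, map_smul, LinearMap.smul_apply, smul_eq_mul,
    mul_sum]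

/-- Finite sums in the second variable. [folklore] -/
theorem cochainForm_sum_right {κ : Type*} (t : Finset κ) (q : ℕ) (f : Cochain R L M q)
    (g : κ → Cochain R L M q) :
    cochainForm B x q f (∑ k ∈ t, g k) = ∑ k ∈ t, cochainForm B x q f (g k) := by
  classical
  induction t using Finset.induction_on with
  | empty =>
    simp only [sum_empty, cochainForm_apply, AlternatingMap.zero_apply, map_zero, sum_const_zero]
  | insert a t ha ih => rw [sum_insert ha, sum_insert ha, cochainForm_add_right, ih]

omit [Fintype ι] in
/-- Insertion is additive in the inserted vector: finite sums. [folklore] -/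
theorem ins_finset_sum {κ : Type*} (t : Finset κ) (q : ℕ) (z : κ → L) (f : Cochain R L M (q + 1)) :
    ins q (∑ k ∈ t, z k) f = ∑ k ∈ t, ins q (z k) f := by
  classical
  induction t using Finset.induction_on with
  | empty => rw [sum_empty, sum_empty, ins_zero_left]
  | insert a t ha ih => rw [sum_insert ha, sum_insert ha, ins_add, ih]

/-- Symmetry, for a symmetric `B`. [folklore] -/
theorem cochainForm_comm (hB : ∀ a b, B a b = B b a) (q : ℕ) (f g : Cochain R L M q) :
    cochainForm B x q f g = cochainForm B x q g f := by
  simp only [cochainForm_apply, hB]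

end Form

/-! ### Horizontal cochains: stability under insertions and the Casimir homotopy -/

section Horizontal

variable (K : LieSubalgebra R L)

/-- Insertion of ANY element keeps a cochain horizontal (insertions anticommute). [folklore] -/
theorem ins_mem_horizontal {q : ℕ} (z : L) {f : Cochain R L M (q + 1)}
    (hf : f ∈ horizontal (M := M) K (q + 1)) : ins q z f ∈ horizontal (M := M) K q := by
  cases q with
  | zero => trivial
  | succ q =>
    rw [mem_horizontal_succ_iff] at hf ⊢
    intro y hy
    rw [ins_ins, hf y hy, map_zero, neg_zero]

/-- Post-composition keeps a cochain horizontal. [folklore] -/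
theorem post_mem_horizontal (ψ : M →ₗ[R] M) {q : ℕ} {f : Cochain R L M q}
    (hf : f ∈ horizontal (M := M) K q) : post L ψ q f ∈ horizontal (M := M) K q := by
  cases q with
  | zero => trivial
  | succ q =>
    rw [mem_horizontal_succ_iff] at hf ⊢
    intro y hy
    rw [ins_post, hf y hy, map_zero]

variable {X : Type*} [Fintype X] (s : L →ₗ[R] Module.End R M) (y y' : X → L)

/-- The Casimir homotopy keeps a cochain horizontal (`i_y h = -h i_y`). [folklore] -/
theorem casimirHomotopy_mem_horizontal {q : ℕ} {f : Cochain R L M (q + 1)}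
    (hf : f ∈ horizontal (M := M) K (q + 1)) :
    casimirHomotopy s y y' q f ∈ horizontal (M := M) K q := by
  cases q with
  | zero => trivial
  | succ q =>
    rw [mem_horizontal_succ_iff] at hf ⊢
    intro z hz
    rw [ins_casimirHomotopy, hf z hz, map_zero, neg_zero]

/-- For the tensor `∑_i x_i ⊗ x_i + ∑_α w_α ⊗ w'_α` with `w'_α ∈ 𝔨` the Casimir homotopy agrees on
`K`-horizontal cochains with its `𝔭`-part `∑_i s(x_i) ∘ i_{x_i}` (the `∂` of loc. cit.).
[cite: BorelWallach2000, II Prop. 2.3 (1)] -/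
theorem casimirHomotopy_sumElim_eq (x : ι → L) {κ : Type*} [Fintype κ] (w w' : κ → L)
    (hw' : ∀ a, w' a ∈ K) {q : ℕ} {f : Cochain R L M (q + 1)} (hf : f ∈ horizontal (M := M) K (q + 1)) :
    casimirHomotopy s (Sum.elim x w) (Sum.elim x w') q f = casimirHomotopy s x x q f := by
  rw [casimirHomotopy_apply, casimirHomotopy_apply, Fintype.sum_sum_type]
  simp only [Sum.elim_inl, Sum.elim_inr]
  rw [add_eq_left]
  exact Finset.sum_eq_zero fun a _ => by
    rw [(mem_horizontal_succ_iff K q f).1 hf _ (hw' a), map_zero]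

end Horizontal

/-! ### Adjunction: `θ_{x_i}` versus `-s(x_i)`, `d` versus `-(q+1) h` -/

section Adjoint

variable [LieRingModule L M] [LieModule R L M]
variable {K : LieSubalgebra R L} {B : M →ₗ[R] M →ₗ[R] R} {x : ι → L} {s : L →ₗ[R] Module.End R M}

/-- **`⟪θ_{x_i} f, g⟫_q = -⟪f, s(x_i) ∘ g⟫_q` for horizontal `f`, `g`**: on tuples of the `x_j`
the Lie derivative is post-composition with `τ(x_i)` (the bracket terms have the argument
`⁅x_i, x_j⁆ ∈ 𝔨`), and `τ(x_i)` is adjoint to `-s(x_i)`.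
[cite: BorelWallach2000, II 2.2 (4)–(5) and proof of Thm. 2.5 (7)] -/
theorem cochainForm_lieDer_left (hxx : ∀ i j, ⁅x i, x j⁆ ∈ K)
    (hadj : ∀ (i : ι) (a b : M), B ⁅x i, a⁆ b = -B a (s (x i) b)) :
    ∀ (q : ℕ) {f g : Cochain R L M q}, f ∈ horizontal (M := M) K q → g ∈ horizontal (M := M) K q →
      ∀ i, cochainForm B x q (lieDer R L M q (x i) f) g = -cochainForm B x q f (post L (s (x i)) q g)
  | 0, f, g, _, _, i => by
    rw [cochainForm_zero, cochainForm_zero, lieDer_zero_apply, post_apply, hadj]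
  | q + 1, f, g, hf, hg, i => by
    rw [cochainForm_succ, cochainForm_succ, ← sum_neg_distrib]
    refine Finset.sum_congr rfl fun j _ => ?_
    have hfj : ins q ⁅x i, x j⁆ f = 0 := (mem_horizontal_succ_iff K q f).1 hf _ (hxx i j)
    rw [ins_lieDer, hfj, sub_zero, ins_post,
      cochainForm_lieDer_left hxx hadj q (ins_mem_horizontal K _ hf) (ins_mem_horizontal K _ hg) i]

/-- **The Casimir homotopy on `𝔭` is the formal adjoint of `d`**:
`⟪d f, g⟫_{q+1} = -(q+1) ⟪f, h g⟫_q`, `h = ∑_i s(x_i) ∘ i_{x_i} = casimirHomotopy s x x`, for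
horizontal `f ∈ C^q`, `g ∈ C^{q+1}` (Cartan's formula and induction on `q`).
[cite: BorelWallach2000, II Prop. 2.3 (1)–(2)] -/
theorem cochainForm_d_left (hxx : ∀ i j, ⁅x i, x j⁆ ∈ K)
    (hadj : ∀ (i : ι) (a b : M), B ⁅x i, a⁆ b = -B a (s (x i) b)) :
    ∀ (q : ℕ) {f : Cochain R L M q} {g : Cochain R L M (q + 1)},
      f ∈ horizontal (M := M) K q → g ∈ horizontal (M := M) K (q + 1) →
      cochainForm B x (q + 1) (d R L M q f) g =
        -(((q + 1 : ℕ) : R) * cochainForm B x q f (casimirHomotopy s x x q g))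
  | 0, f, g, hf, hg => by
    rw [cochainForm_succ, show ((0 + 1 : ℕ) : R) = 1 by norm_num, one_mul, casimirHomotopy_apply,
      cochainForm_sum_right, ← sum_neg_distrib]
    refine Finset.sum_congr rfl fun i _ => ?_
    rw [ins_d_zero, cochainForm_lieDer_left hxx hadj 0 hf (ins_mem_horizontal K _ hg) i]
  | q + 1, f, g, hf, hg => by
    -- `i_{x_i} d f = θ_{x_i} f - d i_{x_i} f`, then the two adjunctions
    have h1 : ∀ i, cochainForm B x (q + 1) (lieDer R L M (q + 1) (x i) f) (ins (q + 1) (x i) g) =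
        -cochainForm B x (q + 1) f (post L (s (x i)) (q + 1) (ins (q + 1) (x i) g)) := fun i =>
      cochainForm_lieDer_left hxx hadj (q + 1) hf (ins_mem_horizontal K _ hg) i
    have h2 : ∀ i, cochainForm B x (q + 1) (d R L M q (ins q (x i) f)) (ins (q + 1) (x i) g) =
        ((q + 1 : ℕ) : R) * cochainForm B x q (ins q (x i) f) (ins q (x i) (casimirHomotopy s x x (q + 1) g)) := by
      intro i
      rw [cochainForm_d_left hxx hadj q (ins_mem_horizontal K _ hf) (ins_mem_horizontal K _ hg),
        ins_casimirHomotopy, cochainForm_neg_right, mul_neg]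
    calc cochainForm B x (q + 1 + 1) (d R L M (q + 1) f) g
        = ∑ i, (cochainForm B x (q + 1) (lieDer R L M (q + 1) (x i) f) (ins (q + 1) (x i) g) -
            cochainForm B x (q + 1) (d R L M q (ins q (x i) f)) (ins (q + 1) (x i) g)) := by
          rw [cochainForm_succ]
          refine Finset.sum_congr rfl fun i _ => ?_
          rw [ins_d_succ, cochainForm_sub_left]
      _ = ∑ i, (-cochainForm B x (q + 1) f (post L (s (x i)) (q + 1) (ins (q + 1) (x i) g)) -
            ((q + 1 : ℕ) : R) * cochainForm B x q (ins q (x i) f)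
              (ins q (x i) (casimirHomotopy s x x (q + 1) g))) :=
          Finset.sum_congr rfl fun i _ => by rw [h1, h2]
      _ = -cochainForm B x (q + 1) f (casimirHomotopy s x x (q + 1) g) -
            ((q + 1 : ℕ) : R) * cochainForm B x (q + 1) f (casimirHomotopy s x x (q + 1) g) := by
          rw [sum_sub_distrib, sum_neg_distrib, ← mul_sum, ← cochainForm_sum_right, ← casimirHomotopy_apply,
            ← cochainForm_succ]
      _ = -(((q + 1 + 1 : ℕ) : R) * cochainForm B x (q + 1) f (casimirHomotopy s x x (q + 1) g)) := by
          push_cast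
          ring

end Adjoint

/-! ### Definiteness and the energy identity (linearly ordered coefficients) -/

section Ordered

variable {R : Type*} [CommRing R] [LinearOrder R] [IsStrictOrderedRing R]
  {L : Type*} [LieRing L] [LieAlgebra R L]
  {M : Type*} [AddCommGroup M] [Module R M]
  {ι : Type*} [Fintype ι]
  {K : LieSubalgebra R L} {B : M →ₗ[R] M →ₗ[R] R} {x : ι → L}

/-- `⟪f, f⟫_q ≥ 0` for a positive semidefinite `B`. [cite: BorelWallach2000, II 2.4] -/
theorem cochainForm_self_nonneg (hB : ∀ a, 0 ≤ B a a) (q : ℕ) (f : Cochain R L M q) :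
    0 ≤ cochainForm B x q f f :=
  Finset.sum_nonneg fun _ _ => hB _

/-- **Definiteness on horizontal cochains**: if `B` is positive semidefinite and definite and
`L = K + span {x i}`, a `K`-horizontal cochain with `⟪f, f⟫_q = 0` is zero (its insertions of the
`x i` vanish by induction, those of `K` by horizontality, hence all). [cite: BorelWallach2000, II 2.4 (2)] -/
theorem eq_zero_of_cochainForm_self_eq_zero (hB : ∀ a, 0 ≤ B a a) (hBd : ∀ a, B a a = 0 → a = 0)
    (hspan : ∀ z : L, ∃ k ∈ K, ∃ c : ι → R, z = k + ∑ i, c i • x i) :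
    ∀ (q : ℕ) {f : Cochain R L M q}, f ∈ horizontal (M := M) K q → cochainForm B x q f f = 0 → f = 0
  | 0, f, _, h0 => by
    rw [cochainForm_zero] at h0
    ext v
    rw [Subsingleton.elim v ![], hBd _ h0, AlternatingMap.zero_apply]
  | q + 1, f, hf, h0 => by
    rw [cochainForm_succ] at h0
    have hi : ∀ i, ins q (x i) f = 0 := fun i =>
      eq_zero_of_cochainForm_self_eq_zero hB hBd hspan q (ins_mem_horizontal K _ hf)
        ((Finset.sum_eq_zero_iff_of_nonneg fun j _ => cochainForm_self_nonneg hB q _).1 h0 i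
          (Finset.mem_univ i))
    refine ext_ins fun z => ?_
    obtain ⟨k, hk, c, rfl⟩ := hspan z
    rw [map_zero, ins_add, (mem_horizontal_succ_iff K q f).1 hf k hk, zero_add]
    rw [ins_finset_sum]
    exact Finset.sum_eq_zero fun i _ => by rw [ins_smul, hi i, smul_zero]

variable [LieRingModule L M] [LieModule R L M] {s : L →ₗ[R] Module.End R M}

/-- **Kuga's lemma, every positive degree** (the energy identity `2.4 (1)` of loc. cit.): for a
RELATIVE cochain `g ∈ C^{q+1}(L, K; M)` whose Laplacian vanishes in the form
`d (h g) + h (d g) = 0` (`h = casimirHomotopy s x x`, e.g. from `d_casimirHomotopy_add` and a null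
Casimir-type operator), `⟪d(hg), g⟫ + ⟪h(dg), g⟫ = -(q+1)‖hg‖² - ‖dg‖²/(q+2) = 0` forces
`d g = 0` AND `h g = 0`: the cochain is closed and coclosed.
[cite: BorelWallach2000, II 2.4 (1)–(2), Thm. 2.5 (iii) and Prop. 3.1 (b)] -/
theorem d_eq_zero_and_casimirHomotopy_eq_zero (hBs : ∀ a b, B a b = B b a) (hB : ∀ a, 0 ≤ B a a)
    (hBd : ∀ a, B a a = 0 → a = 0) (hspan : ∀ z : L, ∃ k ∈ K, ∃ c : ι → R, z = k + ∑ i, c i • x i)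
    (hxx : ∀ i j, ⁅x i, x j⁆ ∈ K) (hadj : ∀ (i : ι) (a b : M), B ⁅x i, a⁆ b = -B a (s (x i) b))
    (q : ℕ) {g : Cochain R L M (q + 1)} (hg : g ∈ (Subcomplex.rel R L M K).carrier (q + 1))
    (hΔ : d R L M q (casimirHomotopy s x x q g) + casimirHomotopy s x x (q + 1) (d R L M (q + 1) g) = 0) :
    d R L M (q + 1) g = 0 ∧ casimirHomotopy s x x q g = 0 := by
  have hgh : g ∈ horizontal (M := M) K (q + 1) := (Submodule.mem_inf.1 hg).2
  have hdg : d R L M (q + 1) g ∈ horizontal (M := M) K (q + 1 + 1) :=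
    (Submodule.mem_inf.1 ((Subcomplex.rel R L M K).d_mem (q + 1) g hg)).2
  have hhg : casimirHomotopy s x x q g ∈ horizontal (M := M) K q := casimirHomotopy_mem_horizontal K s x x hgh
  -- the two energies
  set P : R := cochainForm B x q (casimirHomotopy s x x q g) (casimirHomotopy s x x q g) with hP
  set Q : R := cochainForm B x (q + 1 + 1) (d R L M (q + 1) g) (d R L M (q + 1) g) with hQ
  have hP0 : 0 ≤ P := cochainForm_self_nonneg hB q _
  have hQ0 : 0 ≤ Q := cochainForm_self_nonneg hB (q + 1 + 1) _
  -- `⟪d(hg), g⟫ = -(q+1) P`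
  have e1 : cochainForm B x (q + 1) (d R L M q (casimirHomotopy s x x q g)) g = -(((q + 1 : ℕ) : R) * P) :=
    cochainForm_d_left hxx hadj q hhg hgh
  -- `(q+2) ⟪h(dg), g⟫ = -Q`
  have e2 : ((q + 1 + 1 : ℕ) : R) *
      cochainForm B x (q + 1) (casimirHomotopy s x x (q + 1) (d R L M (q + 1) g)) g = -Q := by
    rw [cochainForm_comm B x hBs, hQ, cochainForm_d_left hxx hadj (q + 1) hgh hdg, neg_neg]
  -- the energy identity
  have e0 : cochainForm B x (q + 1) (d R L M q (casimirHomotopy s x x q g)) g +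
      cochainForm B x (q + 1) (casimirHomotopy s x x (q + 1) (d R L M (q + 1) g)) g = 0 := by
    rw [← cochainForm_add_left, hΔ]
    simp only [cochainForm_apply, AlternatingMap.zero_apply, map_zero, LinearMap.zero_apply, sum_const_zero]
  have key : ((q + 1 + 1 : ℕ) : R) * (((q + 1 : ℕ) : R) * P) + Q = 0 := by
    have h := congrArg (fun t : R => ((q + 1 + 1 : ℕ) : R) * t) e0
    simp only [mul_add, mul_zero] at h
    rw [e1] at h
    linear_combination e2 - h
  have hc1 : (0 : R) < ((q + 1 : ℕ) : R) := by exact_mod_cast Nat.succ_pos q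
  have hc2 : (0 : R) < ((q + 1 + 1 : ℕ) : R) := by exact_mod_cast Nat.succ_pos (q + 1)
  have hprod : 0 ≤ ((q + 1 + 1 : ℕ) : R) * (((q + 1 : ℕ) : R) * P) :=
    mul_nonneg hc2.le (mul_nonneg hc1.le hP0)
  have hQz : Q = 0 := le_antisymm (by linarith) hQ0
  have hPz : P = 0 := by
    have h1 : ((q + 1 + 1 : ℕ) : R) * (((q + 1 : ℕ) : R) * P) = 0 := by linarith
    rcases mul_eq_zero.1 h1 with h | h
    · exact absurd h hc2.ne'
    · rcases mul_eq_zero.1 h with h' | h'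
      · exact absurd h' hc1.ne'
      · exact h'
  exact ⟨eq_zero_of_cochainForm_self_eq_zero hB hBd hspan (q + 1 + 1) hdg hQz,
    eq_zero_of_cochainForm_self_eq_zero hB hBd hspan q hhg hPz⟩

/-- **Degree `0`**: a relative `0`-cochain with `h (d g) = 0` is closed.
[cite: BorelWallach2000, II Prop. 3.1 (b)] -/
theorem d_eq_zero_of_rel_zero (hB : ∀ a, 0 ≤ B a a) (hBd : ∀ a, B a a = 0 → a = 0)
    (hspan : ∀ z : L, ∃ k ∈ K, ∃ c : ι → R, z = k + ∑ i, c i • x i)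
    (hxx : ∀ i j, ⁅x i, x j⁆ ∈ K) (hadj : ∀ (i : ι) (a b : M), B ⁅x i, a⁆ b = -B a (s (x i) b))
    {g : Cochain R L M 0} (hg : g ∈ (Subcomplex.rel R L M K).carrier 0)
    (hΔ : casimirHomotopy s x x 0 (d R L M 0 g) = 0) : d R L M 0 g = 0 := by
  have hdg : d R L M 0 g ∈ horizontal (M := M) K 1 :=
    (Submodule.mem_inf.1 ((Subcomplex.rel R L M K).d_mem 0 g hg)).2
  have e : cochainForm B x 1 (d R L M 0 g) (d R L M 0 g) = 0 := by
    rw [cochainForm_d_left hxx hadj 0 (trivial : g ∈ horizontal (M := M) K 0) hdg, hΔ]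
    simp only [cochainForm_apply, AlternatingMap.zero_apply, map_zero, sum_const_zero, mul_zero, neg_zero]
  exact eq_zero_of_cochainForm_self_eq_zero hB hBd hspan 1 hdg e

open scoped TensorProduct in
/-- **Kuga's lemma from the Casimir match** [cite: BorelWallach2000, II Thm. 2.5 (iii) and
Prop. 3.1 (b)]: let `∑_i x_i ⊗ x_i + ∑_α w_α ⊗ w'_α` (`w'_α ∈ 𝔨`) be an `L`-invariant tensor and
`s` equivariant (`[τ(z), s(u)] = s(⁅z, u⁆)`), so that `d h + h d = N ∘ -` for the full Casimir
homotopy `h` and `N = ∑ s(x_i) τ(x_i) + ∑ s(w_α) τ(w'_α)` (`d_casimirHomotopy_add`; for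
`s = σ - ρ` on `H ⊗ E` and the canonical tensor of the invariant form, `N = σ(C) - ρ(C)`).  If `N`
kills `M` (the Casimir match, Wigner), then under the adjunction and positivity hypotheses of
`d_eq_zero_and_casimirHomotopy_eq_zero` every relative cochain of positive degree is closed and
coclosed. -/
theorem d_eq_zero_of_casimirOp_eq_zero (hBs : ∀ a b, B a b = B b a) (hB : ∀ a, 0 ≤ B a a)
    (hBd : ∀ a, B a a = 0 → a = 0) (hspan : ∀ z : L, ∃ k ∈ K, ∃ c : ι → R, z = k + ∑ i, c i • x i)
    (hxx : ∀ i j, ⁅x i, x j⁆ ∈ K) (hadj : ∀ (i : ι) (a b : M), B ⁅x i, a⁆ b = -B a (s (x i) b))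
    {κ : Type*} [Fintype κ] {w w' : κ → L} (hw' : ∀ a, w' a ∈ K)
    (hσ : ∀ z u : L, LieModule.toEnd R L M z * s u - s u * LieModule.toEnd R L M z = s ⁅z, u⁆)
    (hT : ∀ z : L, ∑ t, (⁅z, Sum.elim x w t⁆ ⊗ₜ[R] Sum.elim x w' t + Sum.elim x w t ⊗ₜ[R] ⁅z, Sum.elim x w' t⁆) =
      (0 : L ⊗[R] L))
    (hN : casimirOp s (Sum.elim x w) (Sum.elim x w') = 0)
    (q : ℕ) {g : Cochain R L M (q + 1)} (hg : g ∈ (Subcomplex.rel R L M K).carrier (q + 1)) :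
    d R L M (q + 1) g = 0 ∧ casimirHomotopy s x x q g = 0 := by
  have hgh : g ∈ horizontal (M := M) K (q + 1) := (Submodule.mem_inf.1 hg).2
  have hdg : d R L M (q + 1) g ∈ horizontal (M := M) K (q + 1 + 1) :=
    (Submodule.mem_inf.1 ((Subcomplex.rel R L M K).d_mem (q + 1) g hg)).2
  refine d_eq_zero_and_casimirHomotopy_eq_zero hBs hB hBd hspan hxx hadj q hg ?_
  have h := d_casimirHomotopy_add (σ := s) (y := Sum.elim x w) (y' := Sum.elim x w') hσ hT q g
  rw [casimirHomotopy_sumElim_eq K s x w w' hw' hgh, casimirHomotopy_sumElim_eq K s x w w' hw' hdg, hN] at h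
  rw [h]
  ext v
  simp only [post_apply, LinearMap.zero_apply, AlternatingMap.zero_apply]

end Ordered

end Literature.Algebra.Lie.ChevalleyEilenberg
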